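import Literature.Analysis.FluidPDE.AlbrittonBlowupCriterion
import Literature.Analysis.FluidPDE.LemarieRieussetSingularPoint
import HarnessLib

/-!
# Albritton's Cor. 4.6 (`albritton_singular_point_of_blowup`): reduction to the `L^∞`
continuation and the far-field bound of Besov mild solutions

Analysis/FluidPDE proof file (no definitions, no named facts) below the named fact
`Literature.Analysis.FluidPDE.albritton_singular_point_of_blowup` (`AlbrittonBlowupCriterion.lean`;
D. Albritton, *Blow-up criteria for the Navier–Stokes equations in non-endpoint critical Besov
spaces*, Anal. PDE 11 (2018) 1415–1456 = arXiv:1612.04439, **Cor. 4.6** with **Prop. 4.5**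
"Formation of singularity at blow-up time": a maximal Besov mild solution with finite lifespan
`T` has a point `x₀` with `u` essentially unbounded on every backward parabolic cylinder
`Q_r(T, x₀)`, `0 < r`, `r² < T`).

## The printed proof (arXiv:1612.04439, proof of Prop. 4.5) and what this file proves

Albritton's proof of Prop. 4.5 (for `L^p` data; Cor. 4.6 applies it at a time `t₀ > 0`, where
the solution of Thm. 4.2 has `u(t₀) ∈ L^p ∩ L^∞` by (4.3)) has two halves:

* **far field** — Calderón's splitting `u₀ = U₀ + V₀`, `U₀ ∈ L² ∩ L^p`, `‖V₀‖_{L^p} < δ`, the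
  energy class of the remainder up to the blow-up time (4.33), the decay (4.36) and the
  `ε`-regularity criterion Thm. 4.8: "there exist constants `R, κ > 0`, and the set
  `K := (ℝ³ ∖ B(R)) × (T*/2, T*)`, such that `sup_K |u(x,t)| < κ`" (4.37);
* **continuation** — "suppose that `u` has no singular points at time `T*`. This assumption,
  paired with the estimate (4.37), implies that `u ∈ L^∞(Q_{ε,T*})`", after which the bilinear
  estimates (4.38) and the propagation Lemma 4.4 in `X = L^∞`, `E = X ∩ L^∞_t L^p_x` prevent
  `‖u(·,t)‖_{L^p}` from blowing up, against the characterisation (i) of the maximal time in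
  Thm. 4.2 — i.e. an `L^∞` bound near `T*` lets the solution continue past `T*`.

In the vocabulary of `CriticalRegularity.lean` (maximality = no Besov mild solution of the same
class on a longer interval agreeing a.e. on `[0, T)`, `IsMaximalBesovMildSolution`) these are the
two class-level statements taken below as the **hypotheses** `hB` (continuation of a Besov mild
solution essentially bounded on a final strip `(T - δ, T) × ℝ³`) and `hC` (essential
boundedness on `(T - δ, T) × B̄(0, R)ᶜ`), written out inline — this file introduces no named
fact (D-0026); they are the Besov-class twins of the tree's Kato-class facts
`IsKatoSolutionOn.continuation_of_bounded` / `IsKatoSolutionOn.farField_bound`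
(`RusinSverakSingularPoint.lean`). The passage "no singular point at time `T*`" + (4.37) ⟹
`u ∈ L^∞(Q_{ε,T*})` is the compactness of `B̄(0, R)`, the tree's
`exists_pos_eLpNorm_lt_top_of_forall_exists_cylinder`. Proved here:

* `albritton_singular_point_of_blowup_of_continuation : hB → hC → albritton_singular_point_of_blowup`
  (the printed contradiction, exactly as `lemarieRieusset_singular_point_of_blowup_of_continuation`
  does it for Kato's `L³` class);
* `continuation_of_bounded_of_albritton_singular_point` — conversely Cor. 4.6 gives back the
  continuation statement outright (a bounded final strip contains the small cylinders at every
  `x₀`, so no `(T, x₀)` is singular and `T` is not maximal). Hence, given the far-field bound,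
  Cor. 4.6 in the tree's phrasing is *equivalent* to the `L^∞` continuation principle for the
  class `IsBesovMildSolutionOn`.

Nothing accepted is restated or changed. What remains below `albritton_singular_point_of_blowup`
after this file: the two hypotheses, each theory-sized for the class `IsBesovMildSolutionOn`
(restart from `Ḃ^{s_p}_{p,q} ∩ L^∞` data with Besov continuity of the Duhamel term and gluing in
the duality form; Calderón splitting of Besov data, Albritton §2, the energy remainder and CKN
`ε`-regularity). **Caveat recorded for their provers:** Albritton's Cor. 4.6 concerns the
solution constructed in Thm. 4.2, which lies in the class (4.3) containing Kato's space `K̊_p`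
(`t^{-s_p/2}‖u(t)‖_{L^p} → 0`); the tree's class carries `K̊_∞` and `C([0,T); Ḃ^{s_p}_{p,q})`
only, so the identification rests on uniqueness in that class, and the gluing step of any
continuation argument in the duality form needs the time-integrability at `0⁺` of the Duhamel
pairing (cf. `intervalIntegrable_duhamelPairing` for `C_t L³`), which `K̊_p` provides
(`O(τ^{s_p})`) and `K̊_∞` alone does not.

## Mathlib / tree search

Tree: `albritton_singular_point_of_blowup`, `IsMaximalBesovMildSolution`,
`IsBesovMildSolutionOn` (`AlbrittonBlowupCriterion.lean`, `CriticalRegularity.lean`);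
`exists_pos_eLpNorm_lt_top_of_forall_exists_cylinder` (`RusinSverakSingularPoint.lean`);
`parabolicCylinder_subset_final_strip` (`LemarieRieussetSingularPoint.lean`); `parabolicCylinder`
(`SuitableWeak.lean`). No continuation / far-field statement for the Besov class exists
(`lean search 'continuation_of_bounded|farField_bound|IsBesovMildSolutionOn\.'`). Mathlib:
`eLpNorm_mono_measure`, `Measure.restrict_mono`, `Real.sqrt`, `Real.sq_sqrt`.

## References

* D. Albritton, *Blow-up criteria for the Navier–Stokes equations in non-endpoint critical Besov
  spaces*, Anal. PDE 11 (2018) 1415–1456 = arXiv:1612.04439 (held, `paper:arxiv-1612.04439`):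
  Thm. 4.2 with (4.3) and Step 4 of its proof, Lemma 4.4, Prop. 4.5 and its proof
  ((4.32)–(4.38)), Cor. 4.6, §4.4 (singular points), Thm. 4.8. Bib key `Albritton2018`.
* P. G. Lemarié-Rieusset, *The Navier–Stokes Problem in the 21st Century*, CRC Press 2016,
  doi:10.1201/b19556, Thm. 15.1 (C) and its proof, PDF pp. 565–566 (the same reduction for
  Kato's `L³` class). Bib key `LemarieRieusset2016`.
* W. Rusin, V. Šverák, J. Funct. Anal. 260 (2011) = arXiv:0911.0500, §4 p. 6 (cited by Albritton
  for the argument: "This argument is based on similar arguments in [rusin, jiasverak]").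
-/

noncomputable section

open MeasureTheory Set Function Filter Metric
open _root_.Topology
open scoped SchwartzMap ENNReal NNReal

namespace Literature.Analysis.FluidPDE

-- `linter.deprecated` is switched off for the next declaration only (and likewise below): it
-- mentions the deprecated (mis-stated, 2026-08-15) tree-class rendering
-- `albritton_singular_point_of_blowup` of Cor. 4.6 (`AlbrittonBlowupCriterion.lean`), whose
-- faithful form `albritton_singular_point_of_blowup_katoClass` is vendored and proved in
-- `AlbrittonSingularPointKatoClassHolds.lean`.
set_option linter.deprecated false in
/-- **Cor. 4.6 from the `L^∞` continuation and the far-field bound of Besov mild solutions**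
(Albritton 2018, arXiv:1612.04439, proof of Prop. 4.5 ⟹ Cor. 4.6). Hypotheses, written inline:
`hB` — *continuation*: a Besov mild solution on `[0, T)` in the class `(s_p, p, q)`,
`3 < p, q < ∞`, `0 < T`, essentially bounded on a final strip `(T - δ, T) × ℝ³`, `δ > 0`, is
extended by a Besov mild solution of the same class on some `[0, T')`, `T' > T`, agreeing with
it a.e. at every time of `[0, T)` (Albritton: (4.38) and Lemma 4.4 in `X = L^∞`,
`E = X ∩ L^∞_t L^p_x`, "This prevents `‖u(·,t)‖_{L^p}` from becoming unbounded as `t ↑ T*`",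
with Thm. 4.2 (i)); `hC` — *far field*: a Besov mild solution on `[0, T)`, `0 < T`, is
essentially bounded on `(T - δ, T) × B̄(0, R)ᶜ` for some `δ > 0`, `R` (Albritton (4.37):
"`sup_K |u(x,t)| < κ`, `K := (ℝ³ ∖ B(R)) × (T*/2, T*)`", from Calderón's splitting, (4.33),
(4.36) and the `ε`-regularity Thm. 4.8). Proof, as printed: if no `x₀` were singular, every
`x₀` carries a bounded cylinder `Q_r(T, x₀)`; with `hC` and the compactness of `B̄(0, R)`
(`exists_pos_eLpNorm_lt_top_of_forall_exists_cylinder`) `u ∈ L^∞((T - δ, T) × ℝ³)` ("implies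
that `u ∈ L^∞(Q_{ε,T*})`"), so by `hB` the solution continues past `T` — against the maximality
of the lifespan (`IsMaximalBesovMildSolution.not_extendable`).
[cite: Albritton2018, Prop. 4.5 (proof, (4.37)–(4.38), Lemma 4.4) and Cor. 4.6] -/
theorem albritton_singular_point_of_blowup_of_continuation
    (hB : ∀ {ν : ℝ} (_ : 0 < ν) {p q : ℝ≥0∞} [Fact (1 ≤ p)] (_ : 3 < p) (_ : p < ∞)
      (_ : 3 < q) (_ : q < ∞) {T : ℝ} (_ : 0 < T) {δ : ℝ} (_ : 0 < δ)
      {u : ℝ → EuclideanSpace ℝ (Fin 3) → EuclideanSpace ℝ (Fin 3)}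
      {U : ℝ → 𝓢'(EuclideanSpace ℝ (Fin 3), EuclideanSpace ℂ (Fin 3))}
      (_ : IsBesovMildSolutionOn (-1 + 3 / p.toReal) p q T ν u U)
      (_ : eLpNorm (uncurry u) ∞
        (volume.restrict (Ioo (T - δ) T ×ˢ (univ : Set (EuclideanSpace ℝ (Fin 3))))) < ∞),
      ∃ T' > T, ∃ (v : ℝ → EuclideanSpace ℝ (Fin 3) → EuclideanSpace ℝ (Fin 3))
        (V : ℝ → 𝓢'(EuclideanSpace ℝ (Fin 3), EuclideanSpace ℂ (Fin 3))),
        IsBesovMildSolutionOn (-1 + 3 / p.toReal) p q T' ν v V ∧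
          ∀ t ∈ Ico 0 T, v t =ᵐ[volume] u t)
    (hC : ∀ {ν : ℝ} (_ : 0 < ν) {p q : ℝ≥0∞} [Fact (1 ≤ p)] (_ : 3 < p) (_ : p < ∞)
      (_ : 3 < q) (_ : q < ∞) {T : ℝ} (_ : 0 < T)
      {u : ℝ → EuclideanSpace ℝ (Fin 3) → EuclideanSpace ℝ (Fin 3)}
      {U : ℝ → 𝓢'(EuclideanSpace ℝ (Fin 3), EuclideanSpace ℂ (Fin 3))}
      (_ : IsBesovMildSolutionOn (-1 + 3 / p.toReal) p q T ν u U),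
      ∃ δ : ℝ, 0 < δ ∧ ∃ R : ℝ, eLpNorm (uncurry u) ∞ (volume.restrict
        (Ioo (T - δ) T ×ˢ (closedBall (0 : EuclideanSpace ℝ (Fin 3)) R)ᶜ)) < ∞) :
    albritton_singular_point_of_blowup := by
  intro ν hν p q _ hp₃ hp hq₃ hq T hT u U hmax
  by_contra hcon
  push Not at hcon
  -- far field (4.37) and a bounded cylinder at every `x` give a bounded final strip
  obtain ⟨δ₀, hδ₀, R, hfar⟩ := hC hν hp₃ hp hq₃ hq hT hmax.isBesovMildSolutionOn
  obtain ⟨δ, hδ, hbd⟩ := exists_pos_eLpNorm_lt_top_of_forall_exists_cylinder hδ₀ hfar fun x => by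
    obtain ⟨r, hr, -, hne⟩ := hcon x
    exact ⟨r, hr, lt_top_iff_ne_top.2 hne⟩
  -- continuation past `T`, contradicting the maximality of the lifespan
  obtain ⟨T', hT', v, V, hv, hvu⟩ := hB hν hp₃ hp hq₃ hq hT hδ hmax.isBesovMildSolutionOn hbd
  exact hmax.not_extendable ⟨T', hT', v, V, hv, hvu⟩

-- `linter.deprecated` off for the next declaration only (deprecated tree-class rendering
-- `albritton_singular_point_of_blowup`, see the note above).
set_option linter.deprecated false in
/-- **Cor. 4.6 gives back the `L^∞` continuation of Besov mild solutions** (Albritton 2018,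
arXiv:1612.04439, Cor. 4.6 read contrapositively; Thm. 4.2 (i): at a finite maximal time
`lim_{t ↑ T*} ‖u(·,t)‖_{L^∞} = ∞`). If a Besov mild solution `(u, U)` on `[0, T)`, `0 < T`, in
the class `(s_p, p, q)`, `3 < p, q < ∞`, is essentially bounded on a strip `(T - δ, T) × ℝ³`,
`δ > 0`, then every cylinder `Q_r(T, x₀)` with `r² ≤ δ` lies in the strip
(`parabolicCylinder_subset_final_strip`), so no `(T, x₀)` is singular; by
`albritton_singular_point_of_blowup` the lifespan `T` is then not maximal, i.e. some Besov mild
solution of the same class on a longer `[0, T')` agrees with `u` a.e. on `[0, T)`. With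
`albritton_singular_point_of_blowup_of_continuation`: given the far-field bound, Cor. 4.6 and the
continuation statement are equivalent. [cite: Albritton2018, Cor. 4.6 and Thm. 4.2 (i)] -/
theorem continuation_of_bounded_of_albritton_singular_point
    (h : albritton_singular_point_of_blowup) {ν : ℝ} (hν : 0 < ν) {p q : ℝ≥0∞} [Fact (1 ≤ p)]
    (hp₃ : 3 < p) (hp : p < ∞) (hq₃ : 3 < q) (hq : q < ∞) {T : ℝ} (hT : 0 < T) {δ : ℝ}
    (hδ : 0 < δ) {u : ℝ → EuclideanSpace ℝ (Fin 3) → EuclideanSpace ℝ (Fin 3)}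
    {U : ℝ → 𝓢'(EuclideanSpace ℝ (Fin 3), EuclideanSpace ℂ (Fin 3))}
    (hu : IsBesovMildSolutionOn (-1 + 3 / p.toReal) p q T ν u U)
    (hbd : eLpNorm (uncurry u) ∞
      (volume.restrict (Ioo (T - δ) T ×ˢ (univ : Set (EuclideanSpace ℝ (Fin 3))))) < ∞) :
    ∃ T' > T, ∃ (v : ℝ → EuclideanSpace ℝ (Fin 3) → EuclideanSpace ℝ (Fin 3))
      (V : ℝ → 𝓢'(EuclideanSpace ℝ (Fin 3), EuclideanSpace ℂ (Fin 3))),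
      IsBesovMildSolutionOn (-1 + 3 / p.toReal) p q T' ν v V ∧
        ∀ t ∈ Ico 0 T, v t =ᵐ[volume] u t := by
  by_contra hcon
  have hmax : IsMaximalBesovMildSolution (-1 + 3 / p.toReal) p q T ν u U := ⟨hu, hcon⟩
  obtain ⟨x₀, hx₀⟩ := h hν hp₃ hp hq₃ hq hT hmax
  -- an admissible radius: `ρ² < T` and `ρ² ≤ δ`
  set ρ : ℝ := min (Real.sqrt T / 2) (Real.sqrt δ) with hρ_def
  have hsqT : 0 < Real.sqrt T := Real.sqrt_pos.2 hT
  have hsqδ : 0 < Real.sqrt δ := Real.sqrt_pos.2 hδ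
  have hρ : 0 < ρ := lt_min (by positivity) hsqδ
  have hρT : ρ ^ 2 < T := by
    have h1 : ρ ≤ Real.sqrt T / 2 := min_le_left _ _
    have h2 : ρ ^ 2 ≤ (Real.sqrt T / 2) ^ 2 := pow_le_pow_left₀ hρ.le h1 2
    have h3 : (Real.sqrt T / 2) ^ 2 = T / 4 := by
      rw [div_pow, Real.sq_sqrt hT.le]; norm_num
    linarith
  have hρδ : ρ ^ 2 ≤ δ := by
    have h1 : ρ ≤ Real.sqrt δ := min_le_right _ _
    have h2 : ρ ^ 2 ≤ Real.sqrt δ ^ 2 := pow_le_pow_left₀ hρ.le h1 2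
    rwa [Real.sq_sqrt hδ.le] at h2
  -- the cylinder norm is infinite but dominated by the finite strip norm
  have hle : eLpNorm (uncurry u) ∞ (volume.restrict (parabolicCylinder ρ ((T : ℝ), x₀))) ≤
      eLpNorm (uncurry u) ∞
        (volume.restrict (Ioo (T - δ) T ×ˢ (univ : Set (EuclideanSpace ℝ (Fin 3))))) :=
    eLpNorm_mono_measure _
      (Measure.restrict_mono (parabolicCylinder_subset_final_strip hρδ x₀) le_rfl)
  rw [hx₀ ρ hρ hρT, top_le_iff] at hle
  exact hbd.ne hle

end Literature.Analysis.FluidPDE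

end
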